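import Mathlib
import HarnessLib
import Literature.AlgebraicGeometry.Resolution.BlowupRingExceptionalFibre
import Literature.AlgebraicGeometry.Resolution.QuadraticTransformsChart

/-!
# The chart origin of the point blow-up of a regular local ring: the closed point `[W]` of the exceptional
# divisor in the chart `D₊(t)` and its local ring, a quadratic transform
# (crux `WildQuotients.WildQuotientResolution`, stub `stub_phaseZeroHighDim`; Kollár–Szabó going down, step (K2))

Crux stmt-ResolutionOfSingularities-15640 (`WildQuotientResolution`), registered stub `stub_phaseZeroHighDim`.
Memo PHASE0-KS-EIGENLINE (hand leafhand-res-wildquotients-8 g0, evidence on the crux) reduces the blow-up-tower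
instance of the named fact `KollarSzaboGoingDown` (on which the negative side-lemma
✓`StandardForm.not_primeOrbitSeparation_of_commuting_conjugates`, p824255, is conditional) to: (K2) the `H`-FIXED
CLOSED POINT of the point blow-up in the chart `D₊(t)` — the ideal `𝔫 = 𝔪·S[𝔪/t] + (W/t)·S[𝔪/t]` for the
`H`-stable tangent hyperplane `𝔪² ≤ W < 𝔪` of ✓`AbelianEigenline.exists_stable_tangentHyperplane` — whose
EXISTENCE (properness of `𝔫`) needs the centre to be REGULAR. This file proves that existence half in the tree's
`Subring K` vocabulary of quadratic transforms (`QuadraticTransforms.lean`), for a regular system of parameters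
`x` adapted to `W` (`t = x_i`, `W = (x_j : j ≠ i) + 𝔪²`):

* `exists_originHom` — abstract form: for a quasi-regular `x` in a ring `R`, `I = (x)`, the affine blow-up algebra
  `R[I/x_i]` has a ring map `ω` to `R/I` with `ω ∘ (R → R[I/x_i]) = (R → R/I)` and `ω (x_j/x_i) = 0` (`j ≠ i`) —
  the origin section of the exceptional chart `R[I/x_i]/(x_i) ≅ (R/I)[T_j]` (tree
  ✓`blowupAlgebra.comap_eval_span_algebraMap_eq`, Stacks 0BIQ);
* `exists_originHom_blowupRing` — for a regular local subring `S ⊆ K` and a regular system of parameters `x`,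
  `x_i ≠ 0`: a ring map `ω : S[𝔪/x_i] → κ(S)` with `ω s = s̄` and `ω (x_j/x_i) = 0`;
* `chartOrigin` package (`exists_chartOrigin`): a MAXIMAL ideal `𝔫` of `S[𝔪/x_i]` with `x_i ∈ 𝔫`, `x_j/x_i ∈ 𝔫`,
  `𝔫 ∩ S = 𝔪`, and every element of `S[𝔪/x_i]` congruent to an element of `S` modulo `𝔫` (residue field `κ(S)`);
* `isQuadraticTransform_ofPrime_blowupRing` — the local ring `S[𝔪/x_i]_𝔫 ⊆ K` at ANY prime `𝔫` of the chart lying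
  over `𝔪` is a quadratic transform of `S` (`IsQuadraticTransform`).

[OURS · crux stmt-ResolutionOfSingularities-15640 · helper toward `stub_phaseZeroHighDim` (step (K2) of the
Kollár–Szabó going-down tower instance; NOT a proof of the stub); folklore blow-up algebra (Stacks 0BIQ), counted 0;
AI-level work, weaker than expert review.] [folklore]
-/

-- single-problem summit: the doubled namespace component `ResolutionOfSingularities` is forced
set_option linter.dupNamespace false

noncomputable section

namespace Summit.ResolutionOfSingularities.ResolutionOfSingularities.Theorems.WildQuotientResolution.EigenlineChart

open IsLocalRing Literature.AlgebraicGeometry.Resolution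

universe u

/-! ## The origin section of the exceptional chart (abstract affine blow-up algebra) -/

section Abstract

variable {R : Type u} [CommRing R] {r : ℕ} (x : Fin r → R) (i : Fin r)

/-- **The origin of the exceptional chart.** For a quasi-regular sequence `x` in `R`, `I = (x)`, the affine blow-up
algebra `R[I/x_i]` admits a ring map `ω : R[I/x_i] → R/I` restricting to `R → R/I` on `R` and killing every
`x_j/x_i`, `j ≠ i`: the composite `R[I/x_i] → R[I/x_i]/(x_i) ≅ (R/I)[T_j : j ≠ i] → R/I` (`T_j ↦ 0`), built from
the presentation `R[T_j] ↠ R[I/x_i]` whose kernel modulo `x_i` is `I·R[T]`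
(✓`blowupAlgebra.comap_eval_span_algebraMap_eq`). [cite: StacksProject, Tag 0BIQ] -/
theorem exists_originHom (hx : IsQuasiRegular x) :
    ∃ ω : blowupAlgebra (Ideal.span (Set.range x)) (x i) →+* R ⧸ Ideal.span (Set.range x),
      (∀ c : R, ω (algebraMap R (blowupAlgebra (Ideal.span (Set.range x)) (x i)) c) =
        Ideal.Quotient.mk _ c) ∧
      ∀ j : Fin r, j ≠ i → ω (blowupAlgebra.frac x i j) = 0 := by
  classical
  let J : Ideal (blowupAlgebra (Ideal.span (Set.range x)) (x i)) :=
    Ideal.span {algebraMap R (blowupAlgebra (Ideal.span (Set.range x)) (x i)) (x i)}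
  let π : MvPolynomial {j : Fin r // j ≠ i} R →+* blowupAlgebra (Ideal.span (Set.range x)) (x i) ⧸ J :=
    (Ideal.Quotient.mk J).comp (blowupAlgebra.eval x i).toRingHom
  have hπsurj : Function.Surjective π :=
    Ideal.Quotient.mk_surjective.comp (blowupAlgebra.eval_surjective x i)
  have hπker : RingHom.ker π = Ideal.map MvPolynomial.C (Ideal.span (Set.range x)) := by
    change RingHom.ker ((Ideal.Quotient.mk J).comp _) = _
    rw [← RingHom.comap_ker, Ideal.mk_ker]
    exact blowupAlgebra.comap_eval_span_algebraMap_eq x i hx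
  let ω₀ : MvPolynomial {j : Fin r // j ≠ i} R →+* R ⧸ Ideal.span (Set.range x) :=
    MvPolynomial.eval₂Hom (Ideal.Quotient.mk _) (fun _ => 0)
  have hker : RingHom.ker π ≤ RingHom.ker ω₀ := by
    rw [hπker]
    refine Ideal.map_le_iff_le_comap.mpr fun c hc => ?_
    rw [Ideal.mem_comap, RingHom.mem_ker, MvPolynomial.eval₂Hom_C, Ideal.Quotient.eq_zero_iff_mem]
    exact hc
  let ω₁ : blowupAlgebra (Ideal.span (Set.range x)) (x i) ⧸ J →+* R ⧸ Ideal.span (Set.range x) :=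
    π.liftOfSurjective hπsurj ⟨ω₀, hker⟩
  have hω₁ : ∀ P, ω₁ (π P) = ω₀ P := fun P => π.liftOfSurjective_comp_apply hπsurj ⟨ω₀, hker⟩ P
  refine ⟨ω₁.comp (Ideal.Quotient.mk J), fun c => ?_, fun j hj => ?_⟩
  · have h := hω₁ (MvPolynomial.C c)
    have hπC : π (MvPolynomial.C c) =
        Ideal.Quotient.mk J (algebraMap R (blowupAlgebra (Ideal.span (Set.range x)) (x i)) c) := by
      change Ideal.Quotient.mk J (blowupAlgebra.eval x i (MvPolynomial.C c)) = _
      rw [blowupAlgebra.eval_C]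
    rw [hπC] at h
    rw [RingHom.comp_apply, h]
    exact MvPolynomial.eval₂Hom_C _ _ c
  · have h := hω₁ (MvPolynomial.X ⟨j, hj⟩)
    have hπX : π (MvPolynomial.X ⟨j, hj⟩) = Ideal.Quotient.mk J (blowupAlgebra.frac x i j) := by
      change Ideal.Quotient.mk J (blowupAlgebra.eval x i (MvPolynomial.X ⟨j, hj⟩)) = _
      rw [blowupAlgebra.eval_X]
    rw [hπX] at h
    rw [RingHom.comp_apply, h]
    exact MvPolynomial.eval₂Hom_X' _ _ _

end Abstract

/-! ## The chart `S[𝔪/x_i] ⊆ K` of a regular local subring -/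

section Chart

variable {K : Type u} [Field K]

/-- **The origin of the exceptional chart, inside `K`.** For a regular local subring `S ⊆ K`, a regular system of
parameters `x` and `x_i ≠ 0`, the chart ring `S[𝔪/x_i] ⊆ K` (`blowupRing`) has a ring map `ω` to the residue
field `κ(S)` with `ω s = s̄` (`s ∈ S`) and `ω (x_j/x_i) = 0` (`j ≠ i`): the closed point `x_j/x_i = 0` of the
exceptional fibre `S[𝔪/x_i]/(x_i) ≅ κ(S)[T_j : j ≠ i]` (✓`blowupRing_chartQuotient`), i.e. the point `[W]`,
`W = (x_j : j ≠ i) + 𝔪²`, of `ℙ(𝔪/𝔪²)`. Transport of `exists_originHom` along `S[𝔪/x_i] ≅ blowupRing S x_i`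
(the isomorphism of ✓`blowupRing_chartQuotient`'s proof). [cite: StacksProject, Tag 0BIQ] -/
theorem exists_originHom_blowupRing (S : Subring K) [IsRegularLocalRing S] {d : ℕ}
    (hd : (maximalIdeal S).spanFinrank = d) (x : Fin d → S)
    (hx : Ideal.span (Set.range x) = maximalIdeal S) (i : Fin d) (hxi : x i ≠ 0) :
    ∃ ω : blowupRing S (x i : K) →+* ResidueField S,
      (∀ s : S, ω ⟨(s : K), le_blowupRing S (x i : K) s.2⟩ = residue S s) ∧
      ∀ j : Fin d, j ≠ i →
        ω ⟨((x j : S) : K) / ((x i : S) : K),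
          div_mem_blowupRing _ (hx ▸ Ideal.subset_span ⟨j, rfl⟩)⟩ = 0 := by
  -- adapted from Literature/AlgebraicGeometry/Resolution/BlowupRingExceptionalFibre.lean (`blowupRing_chartQuotient`)
  classical
  have hxm : ∀ j, x j ∈ maximalIdeal S := fun j => hx ▸ Ideal.subset_span ⟨j, rfl⟩
  have hθ : ((x i : S) : K) ≠ 0 := fun h => hxi (Subtype.ext h)
  have hunit : IsUnit (S.subtype (x i)) := isUnit_iff_ne_zero.mpr hθ
  -- `Θ : S[1/x_i] → K` and `g : S[𝔪/x_i] → K`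
  let Θ : Localization.Away (x i) →+* K := IsLocalization.Away.lift (x i) hunit
  have hΘalg : ∀ s : S, Θ (algebraMap S (Localization.Away (x i)) s) = (s : K) := fun s =>
    IsLocalization.Away.lift_eq (x i) hunit s
  have hΘinv : Θ (IsLocalization.Away.invSelf (x i)) = ((x i : S) : K)⁻¹ := by
    apply eq_inv_of_mul_eq_one_left
    rw [← hΘalg (x i), ← map_mul, mul_comm, IsLocalization.Away.mul_invSelf, map_one]
  let g : blowupAlgebra (Ideal.span (Set.range x)) (x i) →+* K :=
    Θ.comp (blowupAlgebra (Ideal.span (Set.range x)) (x i)).val.toRingHom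
  have hgalg : ∀ s : S, g (algebraMap S (blowupAlgebra (Ideal.span (Set.range x)) (x i)) s) = (s : K) :=
    fun s => hΘalg s
  have hgfrac : ∀ j : Fin d, g (blowupAlgebra.frac x i j) = ((x j : S) : K) / ((x i : S) : K) := by
    intro j
    change Θ ((blowupAlgebra.frac x i j : Localization.Away (x i))) = _
    rw [blowupAlgebra.coe_frac, map_mul, hΘalg, hΘinv, div_eq_mul_inv]
  have hgeval : g.comp (blowupAlgebra.eval x i).toRingHom =
      MvPolynomial.eval₂Hom S.subtype
        (fun j : {j : Fin d // j ≠ i} => ((x j.1 : S) : K) / ((x i : S) : K)) := by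
    refine (blowupAlgebra.comp_val_comp_eval x i Θ).trans ?_
    congr 1
    · ext s
      exact hΘalg s
    · funext j
      exact hgfrac j.1
  have hgeval' : ∀ P, g (blowupAlgebra.eval x i P) = MvPolynomial.eval₂Hom S.subtype
      (fun j : {j : Fin d // j ≠ i} => ((x j.1 : S) : K) / ((x i : S) : K)) P := fun P => by
    rw [← hgeval]; rfl
  have heval_mem : ∀ P : MvPolynomial {j : Fin d // j ≠ i} S, MvPolynomial.eval₂Hom S.subtype
      (fun j : {j : Fin d // j ≠ i} => ((x j.1 : S) : K) / ((x i : S) : K)) P ∈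
        blowupRing S (x i : K) := by
    intro P
    induction P using MvPolynomial.induction_on with
    | C s =>
      rw [MvPolynomial.eval₂Hom_C]
      exact le_blowupRing S _ s.2
    | add p q hp hq =>
      rw [map_add]
      exact Subring.add_mem _ hp hq
    | mul_X p j hp =>
      rw [map_mul, MvPolynomial.eval₂Hom_X']
      exact Subring.mul_mem _ hp (div_mem_blowupRing _ (hxm j.1))
  have hrange : g.range = blowupRing S (x i : K) := by
    apply le_antisymm
    · rintro _ ⟨z, rfl⟩
      obtain ⟨P, rfl⟩ := blowupAlgebra.eval_surjective x i z
      rw [hgeval']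
      exact heval_mem P
    · rw [blowupRing_eq_closure_of_span_eq ((x i : S) : K) (Set.range x) hx, Subring.closure_le]
      rintro z (hz | ⟨y, ⟨j, rfl⟩, rfl⟩)
      · exact ⟨algebraMap S _ ⟨z, hz⟩, hgalg ⟨z, hz⟩⟩
      · exact ⟨blowupAlgebra.frac x i j, hgfrac j⟩
  -- `g` is injective
  have hΘinj : ∀ z, Θ z = 0 → z = 0 := by
    intro z hz
    obtain ⟨⟨r, s⟩, hrs⟩ := IsLocalization.surj (Submonoid.powers (x i)) z
    have hr : (r : K) = 0 := by
      have h := congrArg Θ hrs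
      rw [map_mul, hz, zero_mul, hΘalg] at h
      exact h.symm
    have hr0 : r = 0 := Subtype.ext hr
    rw [hr0, map_zero] at hrs
    exact (IsUnit.mul_left_eq_zero (IsLocalization.map_units _ s)).mp hrs
  have hginj : Function.Injective g := by
    intro a b h
    apply Subtype.ext
    have h0 : Θ ((a : Localization.Away (x i)) - b) = 0 := by
      rw [map_sub]
      exact sub_eq_zero.mpr h
    exact sub_eq_zero.mp (hΘinj _ h0)
  -- `e₁ : S[𝔪/x_i] ≃ blowupRing S x_i`
  have hmem : ∀ b, g b ∈ blowupRing S (x i : K) := fun b => by rw [← hrange]; exact ⟨b, rfl⟩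
  let g' : blowupAlgebra (Ideal.span (Set.range x)) (x i) →+* blowupRing S (x i : K) :=
    g.codRestrict _ hmem
  have hg' : Function.Bijective g' := by
    refine ⟨fun a b h => hginj (congrArg Subtype.val h), fun z => ?_⟩
    have hz : (z : K) ∈ g.range := by rw [hrange]; exact z.2
    obtain ⟨b, hb⟩ := hz
    exact ⟨b, Subtype.ext hb⟩
  let e₁ : blowupAlgebra (Ideal.span (Set.range x)) (x i) ≃+* blowupRing S (x i : K) :=
    RingEquiv.ofBijective g' hg'
  have he₁alg : ∀ s : S, e₁ (algebraMap S (blowupAlgebra (Ideal.span (Set.range x)) (x i)) s) =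
      ⟨(s : K), le_blowupRing S (x i : K) s.2⟩ :=
    fun s => Subtype.ext (hgalg s)
  have he₁frac : ∀ j : Fin d, e₁ (blowupAlgebra.frac x i j) =
      ⟨((x j : S) : K) / ((x i : S) : K), div_mem_blowupRing _ (hxm j)⟩ :=
    fun j => Subtype.ext (hgfrac j)
  -- the abstract origin section, transported
  obtain ⟨ω, hωalg, hωfrac⟩ := exists_originHom x i (isQuasiRegular_regularSystemOfParameters hd x hx)
  let κe : (S ⧸ Ideal.span (Set.range x)) ≃+* ResidueField S := Ideal.quotEquivOfEq hx
  refine ⟨(κe.toRingHom.comp ω).comp e₁.symm.toRingHom, fun s => ?_, fun j hj => ?_⟩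
  · have h1 : e₁.symm ⟨(s : K), le_blowupRing S (x i : K) s.2⟩ =
        algebraMap S (blowupAlgebra (Ideal.span (Set.range x)) (x i)) s := by
      rw [← he₁alg, RingEquiv.symm_apply_apply]
    change κe (ω (e₁.symm ⟨(s : K), le_blowupRing S (x i : K) s.2⟩)) = _
    rw [h1, hωalg]
    rfl
  · have h1 : e₁.symm ⟨((x j : S) : K) / ((x i : S) : K), div_mem_blowupRing _ (hxm j)⟩ =
        blowupAlgebra.frac x i j := by
      rw [← he₁frac, RingEquiv.symm_apply_apply]
    change κe (ω (e₁.symm ⟨((x j : S) : K) / ((x i : S) : K), div_mem_blowupRing _ (hxm j)⟩)) = _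
    rw [h1, hωfrac j hj, map_zero]


/-- **The chart origin `𝔫 ⊂ S[𝔪/x_i]`.** For a regular local subring `S ⊆ K`, a regular system of parameters `x`
and `x_i ≠ 0`, the chart ring `S[𝔪/x_i]` has a MAXIMAL ideal `𝔫` (the kernel of `exists_originHom_blowupRing`'s
`ω`) containing `x_i` and the `x_j/x_i` (`j ≠ i`), lying over `𝔪` (`𝔫 ∩ S = 𝔪`), with residue field `κ(S)`:
every element of `S[𝔪/x_i]` is congruent modulo `𝔫` to an element of `S`. This is the closed point
`[W] ∈ ℙ(𝔪/𝔪²)`, `W = (x_j : j ≠ i) + 𝔪²`, of the exceptional divisor of `Bl_𝔪 Spec S`, read in the chart `D₊(x_i)`;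
its existence uses the regularity of `S` (for a singular `S` the ideal `(x_i, x_j/x_i) S[𝔪/x_i]` may be the unit
ideal). [cite: StacksProject, Tag 0BIQ] -/
theorem exists_chartOrigin (S : Subring K) [IsRegularLocalRing S] {d : ℕ}
    (hd : (maximalIdeal S).spanFinrank = d) (x : Fin d → S)
    (hx : Ideal.span (Set.range x) = maximalIdeal S) (i : Fin d) (hxi : x i ≠ 0) :
    ∃ 𝔫 : Ideal (blowupRing S (x i : K)), 𝔫.IsMaximal ∧
      (⟨((x i : S) : K), le_blowupRing S (x i : K) (x i).2⟩ : blowupRing S (x i : K)) ∈ 𝔫 ∧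
      (∀ j : Fin d, j ≠ i →
        (⟨((x j : S) : K) / ((x i : S) : K), div_mem_blowupRing _ (hx ▸ Ideal.subset_span ⟨j, rfl⟩)⟩ :
          blowupRing S (x i : K)) ∈ 𝔫) ∧
      (∀ s : S, (⟨(s : K), le_blowupRing S (x i : K) s.2⟩ : blowupRing S (x i : K)) ∈ 𝔫 ↔
        s ∈ maximalIdeal S) ∧
      ∀ z : blowupRing S (x i : K), ∃ s : S, z - ⟨(s : K), le_blowupRing S (x i : K) s.2⟩ ∈ 𝔫 := by
  obtain ⟨ω, hωS, hωfrac⟩ := exists_originHom_blowupRing S hd x hx i hxi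
  have hsurj : Function.Surjective ω := fun q => by
    obtain ⟨s, rfl⟩ := residue_surjective q
    exact ⟨_, hωS s⟩
  refine ⟨RingHom.ker ω, RingHom.ker_isMaximal_of_surjective ω hsurj, ?_, ?_, ?_, ?_⟩
  · rw [RingHom.mem_ker, hωS, residue_eq_zero_iff]
    exact hx ▸ Ideal.subset_span ⟨i, rfl⟩
  · intro j hj
    rw [RingHom.mem_ker]
    exact hωfrac j hj
  · intro s
    rw [RingHom.mem_ker, hωS, residue_eq_zero_iff]
  · intro z
    obtain ⟨s, hs⟩ := residue_surjective (ω z)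
    refine ⟨s, ?_⟩
    rw [RingHom.mem_ker, map_sub, hωS, hs, sub_self]

/-! ## The local ring of the chart at a prime over `𝔪` is a quadratic transform -/

/-- **`S[𝔪/t]_𝔫` is a quadratic transform of `S`** (Cutkosky §2.1, verbatim the definition `IsQuadraticTransform`):
for a local subring `S ⊆ K`, `0 ≠ t ∈ 𝔪_S`, and a prime `𝔫` of the chart ring `S[𝔪/t]` containing (the image of)
`𝔪_S`, the local subring `S[𝔪/t]_𝔫 ⊆ K` (`LocalSubring.ofPrime`) is local, contains `S[𝔪/t]`, consists of
fractions `a/b` (`a, b ∈ S[𝔪/t]`, `b⁻¹ ∈ S[𝔪/t]_𝔫`) and dominates `S`. [cite: Cutkosky2014, §2.1] -/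
theorem isQuadraticTransform_ofPrime_blowupRing (S : Subring K) [IsLocalRing S] {t : S}
    (ht : t ∈ maximalIdeal S) (ht0 : t ≠ 0) (𝔫 : Ideal (blowupRing S (t : K))) [𝔫.IsPrime]
    (hover : ∀ s : S, s ∈ maximalIdeal S →
      (⟨(s : K), le_blowupRing S (t : K) s.2⟩ : blowupRing S (t : K)) ∈ 𝔫) :
    IsQuadraticTransform S (LocalSubring.ofPrime (blowupRing S (t : K)) 𝔫).toSubring := by
  have hBR₁ : blowupRing S (t : K) ≤ (LocalSubring.ofPrime (blowupRing S (t : K)) 𝔫).toSubring :=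
    LocalSubring.le_ofPrime _ 𝔫
  have hSR₁ : S ≤ (LocalSubring.ofPrime (blowupRing S (t : K)) 𝔫).toSubring :=
    (le_blowupRing S (t : K)).trans hBR₁
  refine ⟨‹_›, t, ht, ht0, inferInstance, hBR₁, fun z hz => ?_, hSR₁, fun y hy hyinv => ?_⟩
  · obtain ⟨a, s, hs, rfl⟩ := mem_ofPrime_iff.mp hz
    exact ⟨a, a.2, s, s.2, inv_mem_ofPrime hs, rfl⟩
  · -- domination: an element of `S` invertible in `R₁` is a unit of `S`
    by_cases hy0 : y = 0
    · rw [hy0, inv_zero]; exact S.zero_mem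
    by_contra hyS
    -- `y ∈ 𝔪_S` (else `y⁻¹ ∈ S`), so `y ∈ 𝔫`; but `y⁻¹ = a/s` forces `s = y a ∈ 𝔫`
    have hym : (⟨y, hy⟩ : S) ∈ maximalIdeal S := by
      rw [mem_maximalIdeal_iff_inv_not_mem]
      exact Or.inr hyS
    have hyn : (⟨y, le_blowupRing S (t : K) hy⟩ : blowupRing S (t : K)) ∈ 𝔫 := hover ⟨y, hy⟩ hym
    obtain ⟨a, s, hs, has⟩ := mem_ofPrime_iff.mp hyinv
    have hs0 : ((s : blowupRing S (t : K)) : K) ≠ 0 := coe_ne_zero_of_not_mem hs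
    have hsya : s = ⟨y, le_blowupRing S (t : K) hy⟩ * a := by
      apply Subtype.ext
      change (s : K) = y * (a : K)
      have e : y⁻¹ * (s : K) = (a : K) := by
        rw [has, div_mul_cancel₀ _ hs0]
      rw [← e, ← mul_assoc, mul_inv_cancel₀ hy0, one_mul]
    exact hs (hsya ▸ 𝔫.mul_mem_right a hyn)

end Chart

end Summit.ResolutionOfSingularities.ResolutionOfSingularities.Theorems.WildQuotientResolution.EigenlineChart

end
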